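import Summits.BirchSwinnertonDyer.BirchSwinnertonDyer.Theorems.ManinLocalTwoThreeKummerDiamondStepTwoCyclotomic
import Summits.BirchSwinnertonDyer.BirchSwinnertonDyer.Theorems.ManinLocalTwoThreeKummerDiamondStepTwoKummerSubgroup
import Summits.BirchSwinnertonDyer.Rank1Residual.ManinAdditive.KummerDiamondReciprocity
import HarnessLib

/-!
# es's STEP 1–2 ASSEMBLED (D6 ⟸ D5 + D3-fixedness + one odd class): PROPOSITION A of PROOF-Ees185-186 §4 for a lattice-optimal `X₀(N)`-datum in the
# index-`4` world, from THEOREM K (es g39 / T-es-77 `indexFour_kummerDiamondReciprocity`, mod T-es-75 ∧ CES)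
(route `ManinLocalTwoThree`, crux C2 `ManinOddAtFour` stmt-BirchSwinnertonDyer-22967; cell bsd-f2-manin, prover p2 gen 21; LEAD card `kummer_diamond` D3–D6;
`--supports stmt-BirchSwinnertonDyer-22967`)

`propositionA_of_reciprocity`: INPUTS — the printed facts T-es-75 (`optimalGamma1Parametrization_cuspInv_galoisAction`) and CES
(`exists_optimal_gamma1ParametrizationData`) feeding es g39's THEOREM K; the index-`4` world (`hopt`, `h4`); and three residual GEOMETRIC facts stated as
Galois-fixedness on `W₀(ℂ)` (D3/D4, not proved here; the odd point `S₁` is an explicit argument): (R) for every Atkin–Lehner splitting `N = Q·y` the point `R_y = π₀(c₀·{∞,1/y}_f)` has finite order and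
is fixed by `Aut(ℂ/ℚ)` (Manin–Drinfeld + rationality of the cusp `1/y` of `X₀(N)`); (T2) every `2`-torsion point of `W₀(ℂ)` is fixed by `Aut(ℂ/ℚ)` (E-an-152d,
full rational `2`-torsion); (O) some `S₁` with `2S₁` of finite order and `Aut(ℂ/ℚ)`-fixed is moved by complex conjugation (an odd Kummer class, `δ(T₁)`).
OUTPUT — a finite Kummer subgroup `𝒱` (order `≤ 4`) containing the classes `σ ↦ σS − S` of every half of a `2`-torsion point and of every `S_y = π₀(c₀{∞,1/y}/2)`,
and the whole STEP-2 structure of `propositionA_complex`: `2⁵ ∣ N`, `p ≡ 3 (mod 4)`, `𝒱 = {0, h₁, h₂, h₁ + h₂}`, the odd classes, `h₂ = v ⊗ ψ_{−p}`,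
`h₁ : (ℤ/8)ˣ ⥲ im ϖ`.  The Kummer subgroup is built by `exists_kummerSubgroup` on the finite torsion subgroup generated by `W₀(ℂ)[2]`, the `R_y` and `2S₁`.
CONDITIONAL on T-es-75 ∧ CES (statement-only printed facts) and on (R), (T2), (O); nothing about E-es-185, C2, Manin's conjecture or BSD is proved.
No definitions, no sorry. [cite: Stevens1982, §1.3 Thm. 1.3.1] [cite: Stevens1989, §2] [cite: ConradEdixhovenStein2003, §6.1.2]
-/

set_option autoImplicit false
-- lint-debt: the directory name repeats the summit name (sibling precedent `ManinLocalTwoThreeKummerDiamondStepTwoCyclotomic.lean`)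
set_option linter.dupNamespace false

noncomputable section

open scoped MatrixGroups
open CongruenceSubgroup WeierstrassCurve Literature.NumberTheory.EllipticCurves Literature.NumberTheory.EllipticCurves.ModularForms

namespace Summit.BirchSwinnertonDyer.BirchSwinnertonDyer.Theorems.ManinLocalTwoThree.StepTwo

/-- **PROPOSITION A from Kummer–diamond reciprocity** (see the module docstring). [cite: Stevens1989, §2] -/
theorem propositionA_of_reciprocity (hSt : optimalGamma1Parametrization_cuspInv_galoisAction)
    (hCES : exists_optimal_gamma1ParametrizationData) (W₀ : WeierstrassCurve ℚ) [W₀.IsElliptic] [W₀.IsGloballyMinimal]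
    {N : ℕ} [NeZero N] (D₀ : ModularParametrizationData W₀ N)
    (hopt : ∀ z ∈ D₀.L.lattice, ∃ w ∈ periodLattice D₀.f, z = D₀.c * w)
    (h4 : ∀ z : ℂ, z ∈ periodLatticeGamma1 D₀.f ↔ ∃ w ∈ periodLattice D₀.f, z = 2 * w)
    (htors : ∀ Q y : ℕ, Q * y = N → Nat.Coprime Q y → IsOfFinAddOrder (D₀.uniformize ((D₀.c : ℂ) * modularSymbol D₀.f (1 / (y : ℚ)))))
    (hfixR : ∀ Q y : ℕ, Q * y = N → Nat.Coprime Q y → ∀ σ : ℂ ≃ₐ[ℚ] ℂ,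
      Affine.Point.map (W' := W₀) (σ : ℂ →ₐ[ℚ] ℂ) (D₀.uniformize ((D₀.c : ℂ) * modularSymbol D₀.f (1 / (y : ℚ)))) =
        D₀.uniformize ((D₀.c : ℂ) * modularSymbol D₀.f (1 / (y : ℚ))))
    (hfix2 : ∀ S : (W₀.baseChange ℂ).toAffine.Point, 2 • S = 0 → ∀ σ : ℂ ≃ₐ[ℚ] ℂ, Affine.Point.map (W' := W₀) (σ : ℂ →ₐ[ℚ] ℂ) S = S)
    (S₁ : (W₀.baseChange ℂ).toAffine.Point) (hS₁tors : IsOfFinAddOrder (2 • S₁))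
    (hS₁fix : ∀ σ : ℂ ≃ₐ[ℚ] ℂ, Affine.Point.map (W' := W₀) (σ : ℂ →ₐ[ℚ] ℂ) (2 • S₁) = 2 • S₁)
    (hS₁odd : Affine.Point.map (W' := W₀) ((Complex.conjAe.restrictScalars ℚ : ℂ ≃ₐ[ℚ] ℂ) : ℂ →ₐ[ℚ] ℂ) S₁ ≠ S₁) :
    ∃ 𝒱 : AddSubgroup ((ℂ ≃ₐ[ℚ] ℂ) → (W₀.baseChange ℂ).toAffine.Point),
      (∀ S : (W₀.baseChange ℂ).toAffine.Point, 2 • (2 • S) = 0 →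
        (fun σ : ℂ ≃ₐ[ℚ] ℂ ↦ Affine.Point.map (W' := W₀) (σ : ℂ →ₐ[ℚ] ℂ) S - S) ∈ 𝒱) ∧
      (∀ Q y : ℕ, Q * y = N → Nat.Coprime Q y →
        (fun σ : ℂ ≃ₐ[ℚ] ℂ ↦ Affine.Point.map (W' := W₀) (σ : ℂ →ₐ[ℚ] ℂ) (D₀.uniformize ((D₀.c : ℂ) * modularSymbol D₀.f (1 / (y : ℚ)) / 2)) -
          D₀.uniformize ((D₀.c : ℂ) * modularSymbol D₀.f (1 / (y : ℚ)) / 2)) ∈ 𝒱) ∧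
      ((fun σ : ℂ ≃ₐ[ℚ] ℂ ↦ Affine.Point.map (W' := W₀) (σ : ℂ →ₐ[ℚ] ℂ) S₁ - S₁) ∈ 𝒱) ∧
    (
      2 ^ 5 ∣ N ∧
      ∃ (p a b y₂ yp : ℕ) (v : (W₀.baseChange ℂ).toAffine.Point) (h₁ h₂ : (ℂ ≃ₐ[ℚ] ℂ) → (W₀.baseChange ℂ).toAffine.Point),
        p.Prime ∧ p ≠ 2 ∧ p % 4 = 3 ∧ 5 ≤ a ∧ 1 ≤ b ∧ 2 ^ a * y₂ = N ∧ Nat.Coprime (2 ^ a) y₂ ∧ p ^ b * yp = N ∧ Nat.Coprime (p ^ b) yp ∧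
        v ≠ 0 ∧ (∃ γ : Gamma0 N, D₀.uniformize ((D₀.c : ℂ) * cuspSymbol D₀.f γ / 2) = v) ∧ h₁ ∈ 𝒱 ∧ h₂ ∈ 𝒱 ∧ h₁ ≠ h₂ ∧
        h₁ (Complex.conjAe.restrictScalars ℚ) = v ∧ h₂ (Complex.conjAe.restrictScalars ℚ) = v ∧
        (∀ f ∈ 𝒱, f = 0 ∨ f = h₁ ∨ f = h₂ ∨ f = h₁ + h₂) ∧ (∀ f ∈ 𝒱, f (Complex.conjAe.restrictScalars ℚ) ≠ 0 → f = h₁ ∨ f = h₂) ∧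
        (∀ (σ : ℂ ≃ₐ[ℚ] ℂ) (d d' : ℤ), ((d * d' : ℤ) : ZMod N) = 1 →
          σ (Complex.exp (2 * Real.pi * Complex.I / N)) = Complex.exp (2 * Real.pi * Complex.I * d / N) → ∀ γ : Gamma0 N,
          ((((γ : SL(2, ℤ)) 1 1 : ℤ)) : ZMod (2 ^ a)) = (d' : ZMod (2 ^ a)) → ((((γ : SL(2, ℤ)) 1 1 : ℤ)) : ZMod y₂) = 1 →
            h₁ σ = D₀.uniformize ((D₀.c : ℂ) * cuspSymbol D₀.f γ / 2)) ∧
        (∀ (σ : ℂ ≃ₐ[ℚ] ℂ) (d d' : ℤ), ((d * d' : ℤ) : ZMod N) = 1 →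
          σ (Complex.exp (2 * Real.pi * Complex.I / N)) = Complex.exp (2 * Real.pi * Complex.I * d / N) → ∀ γ : Gamma0 N,
          ((((γ : SL(2, ℤ)) 1 1 : ℤ)) : ZMod (p ^ b)) = (d' : ZMod (p ^ b)) → ((((γ : SL(2, ℤ)) 1 1 : ℤ)) : ZMod yp) = 1 →
            h₂ σ = D₀.uniformize ((D₀.c : ℂ) * cuspSymbol D₀.f γ / 2)) ∧
        (∀ (σ : ℂ ≃ₐ[ℚ] ℂ) (d d' : ℤ), ((d * d' : ℤ) : ZMod N) = 1 →
          σ (Complex.exp (2 * Real.pi * Complex.I / N)) = Complex.exp (2 * Real.pi * Complex.I * d / N) → (h₂ σ = 0 ↔ IsSquare ((d : ZMod p)))) ∧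
        (∀ σ : ℂ ≃ₐ[ℚ] ℂ, h₂ σ = 0 ∨ h₂ σ = v) ∧
        (∀ (σ τ : ℂ ≃ₐ[ℚ] ℂ) (d d' e e' : ℤ), ((d * d' : ℤ) : ZMod N) = 1 →
          σ (Complex.exp (2 * Real.pi * Complex.I / N)) = Complex.exp (2 * Real.pi * Complex.I * d / N) → ((e * e' : ℤ) : ZMod N) = 1 →
          τ (Complex.exp (2 * Real.pi * Complex.I / N)) = Complex.exp (2 * Real.pi * Complex.I * e / N) →
          (h₁ σ = h₁ τ ↔ (d : ZMod 8) = (e : ZMod 8))) ∧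
        (∀ γ : Gamma0 N, ∃ σ : ℂ ≃ₐ[ℚ] ℂ, h₁ σ = D₀.uniformize ((D₀.c : ℂ) * cuspSymbol D₀.f γ / 2))
    ) := by
  classical
  -- the Galois operators and the generating set of the torsion subgroup
  set ρ : (ℂ ≃ₐ[ℚ] ℂ) → (W₀.baseChange ℂ).toAffine.Point →+ (W₀.baseChange ℂ).toAffine.Point :=
    fun σ ↦ Affine.Point.map (W' := W₀) (σ : ℂ →ₐ[ℚ] ℂ) with hρ
  set F : Set (W₀.baseChange ℂ).toAffine.Point :=
    {S | 2 • S = 0} ∪ ((fun y : ℕ ↦ D₀.uniformize ((D₀.c : ℂ) * modularSymbol D₀.f (1 / (y : ℚ)))) '' {y : ℕ | y ∣ N ∧ Nat.Coprime (N / y) y}) ∪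
      {2 • S₁} with hF
  have hFfin : F.Finite := by
    refine Set.Finite.union (Set.Finite.union (ncard_twoTorsion_le_four D₀).1 (Set.Finite.image _ ?_)) (Set.finite_singleton _)
    exact Set.Finite.subset (Set.finite_Iic N) fun y hy ↦ Nat.le_of_dvd (Nat.pos_of_ne_zero (NeZero.ne N)) hy.1
  have hdivmul : ∀ {y : ℕ}, y ∣ N → N / y * y = N := fun hy ↦ Nat.div_mul_cancel hy
  have hFtors : ∀ x ∈ F, IsOfFinAddOrder x := by
    rintro x ((hx | ⟨y, ⟨hy, hcop⟩, rfl⟩) | hx)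
    · exact isOfFinAddOrder_iff_nsmul_eq_zero.mpr ⟨2, two_pos, hx⟩
    · exact htors (N / y) y (hdivmul hy) hcop
    · rw [Set.mem_singleton_iff] at hx; rw [hx]; exact hS₁tors
  have hFfix : ∀ σ : ℂ ≃ₐ[ℚ] ℂ, ∀ x ∈ F, ρ σ x = x := by
    rintro σ x ((hx | ⟨y, ⟨hy, hcop⟩, rfl⟩) | hx)
    · exact hfix2 x hx σ
    · exact hfixR (N / y) y (hdivmul hy) hcop σ
    · rw [Set.mem_singleton_iff] at hx; rw [hx]; exact hS₁fix σ
  -- the torsion subgroup `T` generated by `F`: finite, Galois-fixed, containing `W₀(ℂ)[2]`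
  set T : AddSubgroup (W₀.baseChange ℂ).toAffine.Point := AddSubgroup.closure F with hT
  haveI : Finite F := hFfin.to_subtype
  haveI : AddGroup.FG T := inferInstance
  have hTtors : AddMonoid.IsTorsion T := by
    intro g
    have hle : T ≤ AddCommGroup.torsion (W₀.baseChange ℂ).toAffine.Point :=
      (AddSubgroup.closure_le _).mpr fun x hx ↦ (AddCommGroup.mem_torsion x).mpr (hFtors x hx)
    exact AddSubmonoid.isOfFinAddOrder_coe.mp ((AddCommGroup.mem_torsion (g : (W₀.baseChange ℂ).toAffine.Point)).mp (hle g.2))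
  haveI : Finite T := AddCommGroup.finite_of_fg_torsion T hTtors
  have hTfix : ∀ σ : ℂ ≃ₐ[ℚ] ℂ, ∀ t ∈ T, ρ σ t = t := by
    intro σ t ht
    have hle : T ≤ (ρ σ).eqLocus (AddMonoidHom.id _) := (AddSubgroup.closure_le _).mpr fun x hx ↦ hFfix σ x hx
    exact hle ht
  have hT2 : ∀ S : (W₀.baseChange ℂ).toAffine.Point, 2 • S = 0 → S ∈ T := fun S hS ↦
    AddSubgroup.subset_closure (Or.inl (Or.inl hS))
  obtain ⟨𝒱, h𝒱fin, h𝒱card, h𝒱mem⟩ := exists_kummerSubgroup ρ T hTfix hT2 (natCard_ker_two_le_four D₀ T)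
  -- the classes of `S_y` and the odd class
  have hSy : ∀ Q y : ℕ, Q * y = N → Nat.Coprime Q y →
      2 • D₀.uniformize ((D₀.c : ℂ) * modularSymbol D₀.f (1 / (y : ℚ)) / 2) ∈ T := by
    intro Q y hQy hcop
    refine AddSubgroup.subset_closure (Or.inl (Or.inr ⟨y, ⟨⟨Q, by rw [← hQy, mul_comm]⟩, ?_⟩, ?_⟩))
    · have hy0 : 0 < y := Nat.pos_of_ne_zero fun h ↦ NeZero.ne N (by rw [← hQy, h, mul_zero])
      rwa [show N / y = Q from Nat.div_eq_of_eq_mul_left hy0 hQy.symm]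
    · simp only [two_nsmul, ← map_add]; congr 1; ring
  have hKum : ∀ Q y : ℕ, Q * y = N → Nat.Coprime Q y → ∃ f ∈ 𝒱, ∀ (σ : ℂ ≃ₐ[ℚ] ℂ) (d d' : ℤ), ((d * d' : ℤ) : ZMod N) = 1 →
      σ (Complex.exp (2 * Real.pi * Complex.I / N)) = Complex.exp (2 * Real.pi * Complex.I * d / N) →
      ∀ γ : Gamma0 N, ((((γ : SL(2, ℤ)) 1 1 : ℤ)) : ZMod Q) = (d' : ZMod Q) → ((((γ : SL(2, ℤ)) 1 1 : ℤ)) : ZMod y) = 1 →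
        f σ = D₀.uniformize ((D₀.c : ℂ) * cuspSymbol D₀.f γ / 2) := by
    intro Q y hQy hcop
    refine ⟨_, h𝒱mem _ (hSy Q y hQy hcop), fun σ d d' hdd' hσ γ hγQ hγy ↦ ?_⟩
    have hK := Summit.BirchSwinnertonDyer.Rank1Residual.ManinAdditive.KummerDiamond.indexFour_kummerDiamondReciprocity hSt hCES W₀ D₀
      hopt h4 σ d d' hdd' hσ Q y hQy hcop γ hγQ hγy
    simp only [hρ]
    rw [hK, add_sub_cancel_left]
  have hoddV : ∃ f ∈ 𝒱, f (Complex.conjAe.restrictScalars ℚ) ≠ 0 := by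
    refine ⟨_, h𝒱mem S₁ (AddSubgroup.subset_closure (Or.inr rfl)), ?_⟩
    simp only [hρ]
    exact sub_ne_zero.mpr hS₁odd
  refine ⟨𝒱, fun S hS ↦ h𝒱mem S (hT2 _ hS), fun Q y hQy hcop ↦ h𝒱mem _ (hSy Q y hQy hcop),
    h𝒱mem S₁ (AddSubgroup.subset_closure (Or.inr rfl)), ?_⟩
  exact propositionA_complex D₀ hopt h4 𝒱 h𝒱fin h𝒱card hKum hoddV

end Summit.BirchSwinnertonDyer.BirchSwinnertonDyer.Theorems.ManinLocalTwoThree.StepTwo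

end
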